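import Mathlib
import HarnessLib
import Literature.MathematicalPhysics.QuantumFieldTheory.StrongCouplingTorusLimit
import Summits.QuantumFields.YangMills.Theorems.PencilRigidityCurvatureKernelBoundTorusFiniteSizeRateExpect
import Summits.QuantumFields.YangMills.Theorems.ConvexGribovBodyStrongCouplingShapeTorusBound
import Summits.QuantumFields.YangMills.Theorems.PencilRigidityCurvatureKernelBoundTorusFiniteSizeRate

/-!
# `CurvatureKernelBound` — brick `TorusFiniteSizeRateR`: quantitative finite-size control of torus
# Wilson expectations on the closed strong-coupling discs, with the explicit rate `log (r₁ / β')`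
# (crux stmt-QuantumFields-11687, line `coupling-trichotomy`)

The closed-disc, explicit-rate variant of the brick `TorusFiniteSizeRate`
(`…PencilRigidityCurvatureKernelBoundTorusFiniteSizeRate`). There the Schwarz lemma with
multiplicity was applied on the disc of radius `β₁ / 2` for couplings `‖β‖ ≤ β₁ / 4`
(`β₁ = betaOne d ρ`), giving the rate `log 2`. Everything it uses holds on the full disc: the torus
and the free expectations are holomorphic on `‖β‖ < β₁` (`differentiableOn_texpect`,
`differentiableOn_expect`), bounded by `M_F = C (2 e^{1/2})^{|seedsOf B|}` on `‖β‖ ≤ β₁`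
(`norm_texpect_le`, `norm_expect_le`), and their jets cross-stabilise explicitly (`cstabE_expect`).
Hence for any radii `0 < β' < r₁ < β₁` the Schwarz lemma with multiplicity at radius `r₁`
(`norm_le_of_isBigO_pow`) gives, for `‖β‖ ≤ β'`, a region `Λ₀` with
`‖⟨F⟩_Λ(β) - ⟨F⟩_{Λ₀}(β)‖ ≤ 2 M_F (β'/r₁)^n` for `Λ ⊇ Λ₀` and
`‖⟨F ∘ (· ∘ τ)⟩^T_{L+1}(β) - ⟨F⟩_{Λ₀}(β)‖ ≤ 2 M_F (β'/r₁)^n` for `2 (r + n + 3) ≤ L`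
(`norm_sub_expect_le_R`), whence `‖⟨F ∘ (· ∘ τ)⟩^T_{L+1}(β) - a‖ ≤ 4 M_F (β'/r₁)^n` for the limit
`a` of the free expectations along boxes (`norm_texpect_sub_le_R`; boxes are cofinal,
`tendsto_box_atTop_atTop`), and the same for the real parts (`abs_re_texpect_sub_le_R`). Choosing
`n = L - R - 3` yields the registered statement `TorusFiniteSizeRateR` (`d = 4`): the finite-size
rate `A e^{-(log (r₁/β')) (L - R)} = A (β'/r₁)^{L - R}` on the closed coupling disc `|β| ≤ β'`,
with `A = 4 (2 e^{1/2})^{256 n} (r₁/β')^3` depending on `β'`, `r₁` and the number `n` of bonds in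
the support only (`StrongCouplingShape.card_seedsOf_le`), the infinite-volume value being the box
limit of the free-boundary expectations (`zdExpect_eq`,
`wilsonExpectation_toTorusObservable_eq_re_expect`).

## References

* K. Osterwalder, E. Seiler, *Gauge field theories on a lattice*, Ann. Phys. 110 (1978) 440–471,
  §3, Thms. 3.6–3.7 [OsterwalderSeilerAnnPhys1978].
* E. Seiler, *Gauge Theories as a Problem of Constructive Quantum Field Theory and Statistical
  Mechanics*, LNP 159 (1982), Ch. 2–3 [SeilerLNP1982].
-/

noncomputable section

open scoped BigOperators Topology
open MeasureTheory Filter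
open Literature.MathematicalPhysics Literature.MathematicalPhysics.QuantumFieldTheory
open Literature.Probability.LatticeModels

namespace Summit.QuantumFields.YangMills.Theorems.CurvatureKernel

variable {d N : ℕ} {G : Type*}

section ClosedDisc

variable [Group G] [TopologicalSpace G] [IsTopologicalGroup G] [CompactSpace G] [MeasurableSpace G]
  [BorelSpace G] {ρ : G →* Matrix (Fin N) (Fin N) ℂ}

/-! ### The Schwarz lemma with multiplicity at radius `r₁ < betaOne` -/

/-- **Two-sided Schwarz estimate at radius `r₁`.** For a bounded measurable observable `F`
(`‖F‖ ≤ C`) supported on the bond set `B`, every order `n`, radii `0 < β' < r₁ < betaOne d ρ` and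
every `‖β‖ ≤ β'`: there is a region `Λ₀` such that `‖⟨F⟩_Λ(β) - ⟨F⟩_{Λ₀}(β)‖ ≤ 2 M (β'/r₁)^n` for
all `Λ ⊇ Λ₀`, and `‖⟨F ∘ (· ∘ τ)⟩^T_{L+1}(β) - ⟨F⟩_{Λ₀}(β)‖ ≤ 2 M (β'/r₁)^n` for every `L` with
`2 (r + n + 3) ≤ L` whenever the bonds of `B` are based within sup-distance `r` of a lattice point;
`M = C (2 e^{1/2})^{|seedsOf B|}` (explicit cross-stabilisation of jets `cstabE_expect`, the uniform
bounds on `‖β‖ ≤ betaOne d ρ`, and `norm_le_of_isBigO_pow` at radius `r₁`). [folklore] -/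
theorem norm_sub_expect_le_R (hρ : Continuous ρ) {B : Finset (ZdEdge d)} {F : ZdGaugeConfig d G → ℂ}
    (hFm : Measurable F) {C : ℝ} (hFb : ∀ U, ‖F U‖ ≤ C) (hFB : DependsOn F (B : Set (ZdEdge d)))
    (n : ℕ) {β' r₁ : ℝ} (hβ' : 0 < β') (hβr : β' < r₁) (hr1 : r₁ < betaOne d ρ)
    {β : ℂ} (hβ : ‖β‖ ≤ β') :
    ∃ Λ₀ : Finset (Literature.Probability.LatticeModels.Site d),
      (∀ Λ, Λ₀ ⊆ Λ → ‖expect ρ F Λ β - expect ρ F Λ₀ β‖ ≤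
        2 * (C * (2 * Real.exp (1 / 2)) ^ (Plaq.seedsOf B).card) * (β' / r₁) ^ n) ∧
      ∀ (c : Literature.Probability.LatticeModels.Site d) (r L : ℕ),
        (∀ e ∈ B, ∀ k, (e.1 k - c k).natAbs ≤ r) → 2 * (r + n + 3) ≤ L →
          ‖texpect ρ (L + 1) F β - expect ρ F Λ₀ β‖ ≤
            2 * (C * (2 * Real.exp (1 / 2)) ^ (Plaq.seedsOf B).card) * (β' / r₁) ^ n := by
  set b := betaOne d ρ
  have hb0 : 0 < b := betaOne_pos d
  have hr0 : 0 < r₁ := hβ'.trans hβr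
  set M : ℝ := C * (2 * Real.exp (1 / 2)) ^ (Plaq.seedsOf B).card
  have hM0 : 0 ≤ M := (norm_nonneg _).trans
    (norm_expect_le hρ (β := 0) (by rw [norm_zero]; exact hb0.le) hFm hFb hFB ∅)
  -- Schwarz lemma with multiplicity at radius `r₁` for a pair of expectations with the same jet
  have schwarz : ∀ {u v : ℂ → ℂ}, DifferentiableOn ℂ u (Metric.ball 0 b) →
      DifferentiableOn ℂ v (Metric.ball 0 b) → (∀ z : ℂ, ‖z‖ ≤ b → ‖u z‖ ≤ M) →
      (∀ z : ℂ, ‖z‖ ≤ b → ‖v z‖ ≤ M) → JetEq n u v → ‖u β - v β‖ ≤ 2 * M * (β' / r₁) ^ n := by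
    intro u v hu hv hbu hbv hj
    have hdiff : DifferentiableOn ℂ (fun z => u z - v z) (Metric.ball 0 b) := hu.sub hv
    have hbd : ∀ z ∈ Metric.ball (0 : ℂ) b, ‖u z - v z‖ ≤ 2 * M := by
      intro z hz
      rw [Metric.mem_ball, dist_zero_right] at hz
      calc ‖u z - v z‖ ≤ ‖u z‖ + ‖v z‖ := norm_sub_le _ _
        _ ≤ M + M := add_le_add (hbu z hz.le) (hbv z hz.le)
        _ = 2 * M := by ring
    have h := norm_le_of_isBigO_pow hdiff hbd hj (r := r₁) hr0 hr1 (z := β) (hβ.trans hβr.le)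
    have hq : ‖β‖ / r₁ ≤ β' / r₁ := by gcongr
    calc ‖u β - v β‖ ≤ 2 * M * (‖β‖ / r₁) ^ n := h
      _ ≤ 2 * M * (β' / r₁) ^ n :=
          mul_le_mul_of_nonneg_left (pow_le_pow_left₀ (by positivity) hq n) (by positivity)
  obtain ⟨Λ₀, hZ, hT⟩ := cstabE_expect hρ hFm hFb hFB n
  have hbZ : ∀ Λ (z : ℂ), ‖z‖ ≤ b → ‖expect ρ F Λ z‖ ≤ M := fun Λ z hz =>
    norm_expect_le hρ hz hFm hFb hFB Λ
  refine ⟨Λ₀, fun Λ hΛ => ?_, fun c r L hBc hL => ?_⟩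
  · exact schwarz (differentiableOn_expect hρ hFm hFb Λ) (differentiableOn_expect hρ hFm hFb Λ₀)
      (hbZ Λ) (hbZ Λ₀) (hZ Λ hΛ)
  · exact schwarz (differentiableOn_texpect hρ L hFm hFb) (differentiableOn_expect hρ hFm hFb Λ₀)
      (fun z hz => norm_texpect_le hρ hz L hFm hFb hFB) (hbZ Λ₀) (hT c r L hBc hL)

/-! ### The quantitative infinite-volume limit of the torus expectations on the closed discs -/

/-- **Quantitative torus limit on the closed discs, complex coupling.** For `F`, `B`, `n` and radii
`0 < β' < r₁ < betaOne d ρ` as in `norm_sub_expect_le_R`, bonds of `B` based within sup-distance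
`r` of a lattice point, `2 (r + n + 3) ≤ L` and `‖β‖ ≤ β'`: the torus expectation
`⟨F ∘ (· ∘ τ)⟩^T_{L+1}(β)` differs from the limit `a` of the free expectations `⟨F⟩_{box L'}(β)`
along boxes by at most `4 M (β'/r₁)^n` (`norm_sub_expect_le_R`; boxes are cofinal among the finite
regions, `tendsto_box_atTop_atTop`). [folklore] -/
theorem norm_texpect_sub_le_R (hρ : Continuous ρ) {B : Finset (ZdEdge d)}
    {F : ZdGaugeConfig d G → ℂ} (hFm : Measurable F) {C : ℝ} (hFb : ∀ U, ‖F U‖ ≤ C)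
    (hFB : DependsOn F (B : Set (ZdEdge d))) {c : Literature.Probability.LatticeModels.Site d}
    {r n L : ℕ} (hBc : ∀ e ∈ B, ∀ k, (e.1 k - c k).natAbs ≤ r) (hL : 2 * (r + n + 3) ≤ L)
    {β' r₁ : ℝ} (hβ' : 0 < β') (hβr : β' < r₁) (hr1 : r₁ < betaOne d ρ) {β : ℂ} (hβ : ‖β‖ ≤ β')
    {a : ℂ} (ha : Tendsto (fun L' : ℕ => expect ρ F (Literature.Probability.LatticeModels.box d L') β)
      atTop (𝓝 a)) :
    ‖texpect ρ (L + 1) F β - a‖ ≤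
      4 * (C * (2 * Real.exp (1 / 2)) ^ (Plaq.seedsOf B).card) * (β' / r₁) ^ n := by
  obtain ⟨Λ₀, hZ, hT⟩ := norm_sub_expect_le_R hρ hFm hFb hFB n hβ' hβr hr1 hβ
  have h2 : ‖expect ρ F Λ₀ β - a‖ ≤
      2 * (C * (2 * Real.exp (1 / 2)) ^ (Plaq.seedsOf B).card) * (β' / r₁) ^ n := by
    refine le_of_tendsto ((ha.const_sub (expect ρ F Λ₀ β)).norm) ?_
    filter_upwards [(tendsto_box_atTop_atTop d).eventually (eventually_ge_atTop Λ₀)] with L' hL'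
    rw [norm_sub_rev]
    exact hZ _ hL'
  calc ‖texpect ρ (L + 1) F β - a‖
      ≤ ‖texpect ρ (L + 1) F β - expect ρ F Λ₀ β‖ + ‖expect ρ F Λ₀ β - a‖ :=
        norm_sub_le_norm_sub_add_norm_sub _ _ _
    _ ≤ _ := add_le_add (hT c r L hBc hL) h2
    _ = 4 * (C * (2 * Real.exp (1 / 2)) ^ (Plaq.seedsOf B).card) * (β' / r₁) ^ n := by ring

/-- **Quantitative torus limit on the closed discs, real parts.** Under the hypotheses of
`norm_texpect_sub_le_R`, if the real parts of the free expectations `⟨F⟩_{box L'}(β)` converge to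
`a : ℝ` along boxes, then `|Re ⟨F ∘ (· ∘ τ)⟩^T_{L+1}(β) - a| ≤ 4 M (β'/r₁)^n`
(`norm_sub_expect_le_R`, `|Re z| ≤ ‖z‖`, cofinality of boxes). [folklore] -/
theorem abs_re_texpect_sub_le_R (hρ : Continuous ρ) {B : Finset (ZdEdge d)}
    {F : ZdGaugeConfig d G → ℂ} (hFm : Measurable F) {C : ℝ} (hFb : ∀ U, ‖F U‖ ≤ C)
    (hFB : DependsOn F (B : Set (ZdEdge d))) {c : Literature.Probability.LatticeModels.Site d}
    {r n L : ℕ} (hBc : ∀ e ∈ B, ∀ k, (e.1 k - c k).natAbs ≤ r) (hL : 2 * (r + n + 3) ≤ L)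
    {β' r₁ : ℝ} (hβ' : 0 < β') (hβr : β' < r₁) (hr1 : r₁ < betaOne d ρ) {β : ℂ} (hβ : ‖β‖ ≤ β')
    {a : ℝ} (ha : Tendsto (fun L' : ℕ =>
      (expect ρ F (Literature.Probability.LatticeModels.box d L') β).re) atTop (𝓝 a)) :
    |(texpect ρ (L + 1) F β).re - a| ≤
      4 * (C * (2 * Real.exp (1 / 2)) ^ (Plaq.seedsOf B).card) * (β' / r₁) ^ n := by
  obtain ⟨Λ₀, hZ, hT⟩ := norm_sub_expect_le_R hρ hFm hFb hFB n hβ' hβr hr1 hβ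
  have h1 : |(texpect ρ (L + 1) F β).re - (expect ρ F Λ₀ β).re| ≤
      2 * (C * (2 * Real.exp (1 / 2)) ^ (Plaq.seedsOf B).card) * (β' / r₁) ^ n := by
    rw [← Complex.sub_re]
    exact (Complex.abs_re_le_norm _).trans (hT c r L hBc hL)
  have h2 : |(expect ρ F Λ₀ β).re - a| ≤
      2 * (C * (2 * Real.exp (1 / 2)) ^ (Plaq.seedsOf B).card) * (β' / r₁) ^ n := by
    refine le_of_tendsto ((ha.const_sub (expect ρ F Λ₀ β).re).abs) ?_
    filter_upwards [(tendsto_box_atTop_atTop d).eventually (eventually_ge_atTop Λ₀)] with L' hL'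
    rw [abs_sub_comm, ← Complex.sub_re]
    exact (Complex.abs_re_le_norm _).trans (hZ _ hL')
  calc |(texpect ρ (L + 1) F β).re - a|
      ≤ |(texpect ρ (L + 1) F β).re - (expect ρ F Λ₀ β).re| + |(expect ρ F Λ₀ β).re - a| :=
        abs_sub_le _ _ _
    _ ≤ _ := add_le_add h1 h2
    _ = 4 * (C * (2 * Real.exp (1 / 2)) ^ (Plaq.seedsOf B).card) * (β' / r₁) ^ n := by ring

end ClosedDisc

/-! ### The registered statement -/

/-- **Quantitative finite-size control of torus Wilson expectations on the closed strong-coupling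
discs, explicit rate** (`d = 4`). For all radii `0 < β' < r₁ < betaOne 4 ρ` and every `n` there is
`A` (`A = 4 (2 e^{1/2})^{256 n} (r₁/β')^3`, depending on `β'`, `r₁`, `n` only) with: for every
observable `F`, `|F| ≤ 1`, measurable, depending on at most `n` bonds based in `box 4 R`, every real
coupling `|β| ≤ β'`, the box limit `gβ` of the free-boundary expectations `zdExpect ρ β Λ F` and
every `L > R`, the torus Wilson expectation of `F ∘ torusLift` on the torus of side `2L + 1` is
within `A e^{-(log (r₁/β')) (L - R)} = A (β'/r₁)^{L - R}` of `gβ`. Proof: the torus expectation is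
`Re ⟨F ∘ (· ∘ τ)⟩^T_{2L+1}(β)` (`wilsonExpectation_toTorusObservable_eq_re_expect`), `gβ` is the
limit of `Re ⟨F⟩_{box L'}(β)` (`zdExpect_eq`), and `abs_re_texpect_sub_le_R` with order `L - R - 3`
(the trivial bound `2 M` for `L - R ≤ 2`); Osterwalder–Seiler 1978, Thms. 3.6–3.7 in quantitative
form, Schwarz lemma with multiplicity at radius `r₁`. [folklore] -/
theorem TorusFiniteSizeRateR : ∀ (N : ℕ) (G : Type) [Group G] [TopologicalSpace G] [IsTopologicalGroup G] [CompactSpace G] [T2Space G] [SecondCountableTopology G] [MeasurableSpace G] [BorelSpace G] (ρ : G →* Matrix (Fin N) (Fin N) ℂ), Continuous ρ → ∀ (β' r₁ : ℝ), 0 < β' → β' < r₁ → r₁ < betaOne 4 ρ → ∀ n : ℕ, ∃ A : ℝ, ∀ (B : Finset (Literature.MathematicalPhysics.QuantumLattice.ZdEdge 4)) (R : ℕ), B.card ≤ n → (∀ e ∈ B, e.1 ∈ Literature.Probability.LatticeModels.box 4 R) → ∀ (F : Literature.MathematicalPhysics.QuantumFieldTheory.ZdGaugeConfig 4 G → ℝ),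 Measurable F → (∀ U, |F U| ≤ 1) → DependsOn F (B : Set (Literature.MathematicalPhysics.QuantumLattice.ZdEdge 4)) → ∀ (β gβ : ℝ), |β| ≤ β' → Literature.Probability.LatticeModels.HasBoxLimit (fun Λ => Literature.MathematicalPhysics.QuantumFieldTheory.zdExpect ρ β Λ F) gβ → ∀ L : ℕ, R < L → |Literature.MathematicalPhysics.QuantumFieldTheory.wilsonExpectation (d := 4) (L := 2 * L + 1) ρ β (Literature.MathematicalPhysics.QuantumLattice.toTorusObservable (2 * L + 1) F) - gβ| ≤ A * Real.exp (-(Real.log (r₁ / β') * ((L : ℝ) - R))) := by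
  intro N G _ _ _ _ _ _ _ _ ρ hρ β' r₁ hβ' hβr hr1 n
  have hr0 : 0 < r₁ := hβ'.trans hβr
  have hq0 : 0 < β' / r₁ := div_pos hβ' hr0
  have hq1 : β' / r₁ ≤ 1 := (div_le_one hr0).2 hβr.le
  have hq3 : (β' / r₁) ^ 3 ≠ 0 := pow_ne_zero 3 hq0.ne'
  have hK1 : (1 : ℝ) ≤ 2 * Real.exp (1 / 2) := by
    have := Real.one_le_exp (show (0 : ℝ) ≤ 1 / 2 by norm_num)
    linarith
  obtain ⟨M₀, hM₀⟩ : ∃ M₀ : ℝ, M₀ = (2 * Real.exp (1 / 2)) ^ (n * (2 ^ 4 * (4 * 4))) := ⟨_, rfl⟩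
  have hM₀1 : (1 : ℝ) ≤ M₀ := hM₀ ▸ one_le_pow₀ hK1
  have hM₀0 : 0 < M₀ := one_pos.trans_le hM₀1
  refine ⟨4 * M₀ / (β' / r₁) ^ 3, ?_⟩
  intro B R hBn hBR F hFm hFb hFB β gβ hβ hlim L hRL
  -- complexification of the observable
  set Fc : ZdGaugeConfig 4 G → ℂ := fun U => (F U : ℂ) with hFc
  have hFcm : Measurable Fc := Complex.measurable_ofReal.comp hFm
  have hFcb : ∀ U, ‖Fc U‖ ≤ 1 := fun U => by
    simp only [hFc, Complex.norm_real, Real.norm_eq_abs]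
    exact hFb U
  have hFcB : DependsOn Fc (B : Set (ZdEdge 4)) := fun U V h => by simp only [hFc, hFB h]
  have hβc : ‖(β : ℂ)‖ ≤ β' := by rwa [Complex.norm_real, Real.norm_eq_abs]
  have hβ1 : ‖(β : ℂ)‖ ≤ betaOne 4 ρ := by linarith
  -- the box limit `gβ` is the limit of the real parts of the complex-coupling free expectations
  have hre : ∀ Λ, zdExpect ρ β Λ F = (expect ρ Fc Λ β).re := fun Λ => by
    rw [zdExpect_eq hρ β Λ hFm hFb]
    rfl
  have ha : Tendsto (fun L' : ℕ =>
      (expect ρ Fc (Literature.Probability.LatticeModels.box 4 L') β).re) atTop (𝓝 gβ) :=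
    Filter.Tendsto.congr (fun L' => hre (Literature.Probability.LatticeModels.box 4 L')) hlim
  -- the torus Wilson expectation as the real part of the torus expectation of the twisted observable
  have hT : wilsonExpectation (L := 2 * L + 1) ρ β (QuantumLattice.toTorusObservable (2 * L + 1) F) =
      (texpect ρ (2 * L + 1) Fc β).re :=
    wilsonExpectation_toTorusObservable_eq_re_expect (L := 2 * L + 1) ρ hρ β hFm hFb
  -- the uniform bound depends on `n` only
  have hMM₀ : (1 : ℝ) * (2 * Real.exp (1 / 2)) ^ (Plaq.seedsOf B).card ≤ M₀ := by
    rw [one_mul, hM₀]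
    exact pow_le_pow_right₀ hK1 ((StrongCouplingShape.card_seedsOf_le B).trans (Nat.mul_le_mul_right _ hBn))
  -- the explicit rate
  have hexp : Real.exp (-(Real.log (r₁ / β') * ((L : ℝ) - R))) = (β' / r₁) ^ (L - R) := by
    rw [← Nat.cast_sub hRL.le, Real.exp_neg, mul_comm, Real.exp_nat_mul,
      Real.exp_log (div_pos hr0 hβ'), ← inv_pow, inv_div]
  rw [hT, hexp]
  by_cases h3 : R + 3 ≤ L
  · -- the main case: order `L - R - 3`
    have hBc : ∀ e ∈ B, ∀ k, (e.1 k - (0 : Literature.Probability.LatticeModels.Site 4) k).natAbs ≤ R := by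
      intro e he k
      have := (Literature.Probability.LatticeModels.mem_box.1 (hBR e he)) k
      simp only [Pi.zero_apply, sub_zero]
      omega
    have hmain := abs_re_texpect_sub_le_R hρ hFcm hFcb hFcB (n := L - R - 3) (L := 2 * L) hBc
      (by omega) hβ' hβr hr1 hβc ha
    calc |(texpect ρ (2 * L + 1) Fc ↑β).re - gβ|
        ≤ 4 * (1 * (2 * Real.exp (1 / 2)) ^ (Plaq.seedsOf B).card) * (β' / r₁) ^ (L - R - 3) := hmain
      _ ≤ 4 * M₀ * (β' / r₁) ^ (L - R - 3) := by gcongr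
      _ = 4 * M₀ / (β' / r₁) ^ 3 * (β' / r₁) ^ (L - R) := by
          obtain ⟨m, hm⟩ : ∃ m : ℕ, m = L - R - 3 := ⟨_, rfl⟩
          have e : L - R = m + 3 := by omega
          rw [← hm, e, pow_add, mul_comm ((β' / r₁) ^ m) ((β' / r₁) ^ 3), ← mul_assoc,
            div_mul_cancel₀ _ hq3]
  · -- small `L - R`: the trivial bound
    have hn1 : |(texpect ρ (2 * L + 1) Fc ↑β).re| ≤ 1 * (2 * Real.exp (1 / 2)) ^ (Plaq.seedsOf B).card :=
      (Complex.abs_re_le_norm _).trans (norm_texpect_le hρ hβ1 (2 * L) hFcm hFcb hFcB)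
    have hn2 : |gβ| ≤ 1 * (2 * Real.exp (1 / 2)) ^ (Plaq.seedsOf B).card :=
      le_of_tendsto' ha.abs fun L' =>
        (Complex.abs_re_le_norm _).trans (norm_expect_le hρ hβ1 hFcm hFcb hFcB _)
    have hLR : L - R ≤ 3 := by omega
    have hpow : (β' / r₁) ^ 3 ≤ (β' / r₁) ^ (L - R) := pow_le_pow_of_le_one hq0.le hq1 hLR
    calc |(texpect ρ (2 * L + 1) Fc ↑β).re - gβ|
        ≤ 1 * (2 * Real.exp (1 / 2)) ^ (Plaq.seedsOf B).card
            + 1 * (2 * Real.exp (1 / 2)) ^ (Plaq.seedsOf B).card :=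
          (abs_sub _ _).trans (add_le_add hn1 hn2)
      _ ≤ 4 * M₀ := by linarith
      _ = 4 * M₀ / (β' / r₁) ^ 3 * (β' / r₁) ^ 3 := (div_mul_cancel₀ _ hq3).symm
      _ ≤ 4 * M₀ / (β' / r₁) ^ 3 * (β' / r₁) ^ (L - R) := by gcongr

end Summit.QuantumFields.YangMills.Theorems.CurvatureKernel

end
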